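import Summits.BirchSwinnertonDyer.BirchSwinnertonDyer.Theses.PrintX8
import Summits.BirchSwinnertonDyer.BirchSwinnertonDyer.Theorems.PrintX8SharpFlatRankZeroRoad
import Summits.BirchSwinnertonDyer.BirchSwinnertonDyer.Theorems.SignedLowerHalvesSprungLowerDivisibilityAtThreeSurjBranch
import Summits.BirchSwinnertonDyer.BirchSwinnertonDyer.Theorems.PrintX8SmallImageMuReading
import Summits.BirchSwinnertonDyer.BirchSwinnertonDyer.Theorems.PrintX8SharpFlatMuTransfer
import Literature.NumberTheory.EllipticCurves.BurungaleKobayashiOta2024.RankOnePPartOfSharpFlatMainConjecture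
import HarnessLib

/-!
# Route `PrintX8` (rev 17) — the X8 leaf `WAllCornerX8` as ONE kernel theorem from the route's two
# OPEN cruxes BY ITEM NAME: K1 `SprungLowerDivisibilityAtThree` (stmt-19875) and the analytic rider
# `SharpFlatMuAnSmallImageX8` (stmt-20714), modulo the held published inputs and GZK
# (cell `bsd-print-x8`, D-0131 (2) print tier, prover seat p1 gen 3 «Sprung 2024 (a_p ≠ 0 ♯♭
# main-conjecture consequences for BSD_p) BY NAME: acquire, type, discharge»; `--supports` 20714;
# the composition of the route's CLOSED glue items over route-independent theorems — nothing else)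

PARTITION (cell bsd-print-x8, leaf `ClassX8` = K3 row A8 = W-ALL row 8; 217 census cells, 61 of them
with image `N_ns⁺(3)`): closes NOTHING; 0 census cells move; BSD is not proved by any of this. The
leaf stays OPEN exactly as its two named residual cruxes are open: K1 (no engine in print at
`(3, a₃ = ±3)`: Sprung 2024 Thm. 1.1 ⇐ Conj. 3.33 ∧ CLW22 Thm. 8.2.1 at `ξ = 𝟙` ∧ square-free `N`,
p1 g2 verdict) and An (= Perrin-Riou 2003 Conj. 7.1 `µ₊ = µ₋ = 0` on the small-image X8 family, read
♯/♭ by parity; census 61/61 two-engine certified `μ(θ_3..5) = 0`, ty3 g2). beyond-print theorem: no.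

HONEST FRAMING. After rev 8/11/12 (planner g2) every glue and assembly item of route `PrintX8` that
is provable now is CLOSED in the kernel: `Assembly` (20314, `PrintX8Assembly.assembly_holds`),
`GlueMainConjectureX8` (20404, `PrintX8MainConjectureSplit.glueMainConjectureX8_holds`),
`GlueRankOneLinkX8` / `GlueRankZeroLinkX8` / `PublishedInputsX8OfParts` (20408 / 20409 / 20416,
`PrintX8Glue.*_holds`), `GlueMuBoundSmallImageX8` (20623, `PrintX8MuBoundGlue.glueMuBoundSmallImageX8_holds`)
and `GlueMuAnSmallImageX8` (20716, `PrintX8MuAnGlue.glueMuAnSmallImageX8_holds`, this seat). THIS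
FILE composes the same chain ONCE, so that the cell's residual statement is legible as a single
declaration whose hypotheses are route decls BY NAME: the OPEN cruxes `SprungLowerDivisibilityAtThree`
(19875) and `SharpFlatMuAnSmallImageX8` (20714), the held inputs `InputSharpFlatMuTransfer` (20771 =
`InputSharpFlatColemanKatoZeta ∧ InputPeriodUnitThree`) / `PublishedInputsX8` (20403, eight
Literature named facts) and `RankEqAnalyticRankLeOne` (19921, GZK). The chain: An + 20771 ⟹ Mu
(p545102 `PrintX8SharpFlatMuTransfer.muBound_smallImageX8_of_sharpFlatMuAn`); K1 + Mu + Pub ⟹ the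
small-image ♯/♭ main conjecture (p539576 `PrintX8MuReading.X8.…_of_lowerDivisibility_of_muInvariant_le`);
K1 + Pub ⟹ the big-image branch (p534029's squeeze
`X8.sprungSharpFlatMainConjecture_of_lowerDivisibility_of_surj`); Pub + GZK ⟹ the two print links
(p533869 `X8.missingPPartAt_of_sprungSharpFlatMainConjecture_of_analyticRank_eq_zero`; ty1's ♯/♭
reading of Burungale–Kobayashi–Ota Cor. A.5 `missingPPartAt_of_corA5_sharpFlat`); `bsdp_of_missingPPartAt`.
THESES-CONE HYGIENE: this module imports the route file `Theses/PrintX8.lean` and, besides it, only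
modules OUTSIDE that route's cone (none of the six glue modules, each of which imports the route file),
re-deriving each glue step by the same one-liners; the one cone it does enter is route
`SignedLowerHalves`'s, through p534029's big-image squeeze module (imported likewise by p2's
`PrintX8MainConjectureSplit` and p3's `PrintX8SmallImageMuGlue`; the gate's dedup rule forbids
re-deriving that landed theorem here). CONDITIONAL content: exactly the displayed hypotheses; nothing is asserted about any
curve; K1 and An are OPEN class-wide and are NOT dressed as facts.

References: [Sprung2012] Prop. 6.14 (p. 1498), Thm. 7.14, Thm. 7.16, Prop. 7.19, Main Conj. 7.21
(pp. 1504–1505); [Sprung2017] Thm. 1.12; [Sprung2024] Thm. 5.3 and §5.2 (pp. 38–41); [Wuthrich2014]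
Lemma 20 (p. 399); [BurungaleKobayashiOta2023] App. A Cor. A.5; [PerrinRiou2003] §7.1 Conj. 7.1 (p. 170);
[Miller2011LMS] Def. 1.1; files `Theses/PrintX8.lean` (rev 17, commit e1f2db40b3e1), p533869, p534029,
p539576, p545102, p532534/p533144.
-/

set_option autoImplicit false
-- justification: the mandated namespace `Summit.BirchSwinnertonDyer.BirchSwinnertonDyer.Theorems`
-- (single-conjunct summit, Sub = Summit) repeats a segment by design (D-0017).
set_option linter.dupNamespace false

noncomputable section

namespace Summit.BirchSwinnertonDyer.BirchSwinnertonDyer.Theorems.PrintX8Residual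

open scoped Classical NumberField MatrixGroups ModularForm
open NumberField IsDedekindDomain WeierstrassCurve CongruenceSubgroup
  Literature.NumberTheory.EllipticCurves Literature.NumberTheory.EllipticCurves.ModularForms
  Literature.NumberTheory.EllipticCurves.Rank1Residual
  Literature.NumberTheory.EllipticCurves.Rank1Residual.Typed
  Literature.NumberTheory.EllipticCurves.Sprung2017 Literature.NumberTheory.EllipticCurves.Sprung2012
  Literature.NumberTheory.EllipticCurves.Sprung2024
  Literature.NumberTheory.EllipticCurves.BurungaleKobayashiOta2024
  Summit.BirchSwinnertonDyer.BirchSwinnertonDyer.Theses.PrintX8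
  Summit.BirchSwinnertonDyer.BirchSwinnertonDyer.Theorems
  Summit.BirchSwinnertonDyer.BirchSwinnertonDyer.Theorems.X8MainConjectureRoad

/-- **The X8 leaf from the two open cruxes BY ITEM NAME (route `PrintX8` rev 17).** K1
`SprungLowerDivisibilityAtThree` (stmt-19875, OPEN) → the analytic rider `SharpFlatMuAnSmallImageX8`
(stmt-20714, OPEN; = Perrin-Riou 2003 Conj. 7.1 on the small-image X8 family) → the held inputs of the
`μ`-transfer `InputSharpFlatMuTransfer` (stmt-20771) → the held published inputs `PublishedInputsX8`
(stmt-20403) → Gross–Zagier–Kolyvagin `RankEqAnalyticRankLeOne` (stmt-19921) → `WAllCornerX8`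
(BSD(E,3) on every X8 pair of analytic rank `≤ 1`). Per pair `(W, 3)` of analytic rank `r ≤ 1`: Sprung's
♯/♭ main conjecture for every colour — on `surj(3)` from K1 by the big-image squeeze (Thm. 7.14, Thm.
7.16 with Wuthrich Lemma 20, period unit), on `¬ surj(3)` from K1 and the `μ`-bound, itself from the
rider by the Euler-system `μ`-transfer (p545102) —; then `r = 0`: Sprung 2024 §5.2 road (p533869),
`r = 1`: BKO Cor. A.5 in the ♯/♭ reading at an admissible colour (newform by BCDT, Sprung pair by Sprung
2017 Thm. 1.12, `L^• ≠ 0` by Prop. 6.14); `bsdp_of_missingPPartAt` with GZK. The composition of the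
route's six CLOSED glue items (20716, 20623, 20404, 20408, 20409, 20314), re-derived from the
route-independent theorems they call.
CONDITIONAL on the displayed hypotheses; closes nothing.
[cite: Sprung2012, Prop. 6.14 (p. 1498), Thm. 7.14, Thm. 7.16, Prop. 7.19 and Main Conj. 7.21 (pp. 1504–1505)]
[cite: Sprung2024, Thm. 5.3 (p. 38) and §5.2 (pp. 39–41)] [cite: Wuthrich2014, Lemma 20 (p. 399)]
[cite: BurungaleKobayashiOta2023, App. A Cor. A.5] [cite: Sprung2017, Thm. 1.12]
[cite: PerrinRiou2003, §7.1 Conj. 7.1 (p. 170)] [cite: Miller2011LMS, §1 and Def. 1.1] -/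
theorem wAllCornerX8_of_K1_of_sharpFlatMuAn (hK1 : SprungLowerDivisibilityAtThree)
    (hAn : SharpFlatMuAnSmallImageX8) (hIn : InputSharpFlatMuTransfer) (hPub : PublishedInputsX8)
    (hGZK : RankEqAnalyticRankLeOne) : Summit.BirchSwinnertonDyer.WAllCornerX8 := by
  obtain ⟨hCK, h3'⟩ := hIn
  obtain ⟨hA5, hmodf, h22, h714, h716, h59, h3, hmod⟩ := hPub
  intro W _ _ p _ _ hX hr
  -- C1 at the pair: Sprung's ♯/♭ main conjecture for every colour (glue items 20716, 20623, 20404)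
  have hMC : ∀ col : Chroma, SprungSharpFlatMainConjecture W p col := by
    intro col
    by_cases hs : Surj W p
    · exact X8.sprungSharpFlatMainConjecture_of_lowerDivisibility_of_surj h714 h716 h3 W p hX hs col
        (hK1 W p hX col)
    · exact PrintX8MuReading.X8.sprungSharpFlatMainConjecture_of_lowerDivisibility_of_muInvariant_le
        h714 h716 h3 W p hX col (hK1 W p hX col)
        (PrintX8SharpFlatMuTransfer.muBound_smallImageX8_of_sharpFlatMuAn hCK h3' hAn W p hX hs hr col)
  -- the two print links (glue items 20409, 20408) and the assembly (20314)
  rcases Nat.le_one_iff_eq_zero_or_eq_one.mp hr with h0 | h1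
  · exact bsdp_of_missingPPartAt W p hGZK hr
      (X8.missingPPartAt_of_sprungSharpFlatMainConjecture_of_analyticRank_eq_zero hmodf h22 h714 h59
        h3 hGZK hmod W p hX h0 hMC)
  · have hp3 : p = 3 := hX.1
    subst hp3
    have hgood : W.HasGoodReductionAtPrime 3 := hX.2.1.1
    have hdvd : ((3 : ℕ) : ℤ) ∣ W.frobeniusTrace 3 := hX.2.1.2
    haveI : NeZero (W.conductorNorm ℤ) := ⟨(W.conductorNorm_pos_holds).ne'⟩
    obtain ⟨f, hf⟩ := hmodf W
    obtain ⟨Lsharp, Lflat, hSP⟩ :=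
      thm112_exists_isSprungPair_holds (W := W) (f := f) (p := 3) (by decide) hf hgood hdvd
    obtain ⟨col, hcol⟩ := hSP.exists_chromaticL_ne_zero hf hgood
    exact bsdp_of_missingPPartAt W 3 hGZK hr
      (missingPPartAt_of_corA5_sharpFlat W 3 hA5 hmod hGZK col (by decide) hgood hdvd h1 f
        (not_dvd_level_of_isNewformOf hf hgood) Lsharp Lflat hf hSP hcol (hMC col))

/-- **Same, with the `μ`-transfer's construction fact alone displayed** (`InputSharpFlatColemanKatoZeta`,
stmt-20772 = `Sprung2012.thm714seq_sharpFlatColemanKato_zeta`, p543968): the period unit at `3`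
(`InputPeriodUnitThree`, the other conjunct of 20771) is conjunct 7 of `PublishedInputsX8`, so the
leaf reads «K1 ∧ An» modulo `PublishedInputsX8 ∧ InputSharpFlatColemanKatoZeta ∧ GZK` — nine
Literature named facts by name plus GZK, every one statement-only with its printed hypotheses.
CONDITIONAL; closes nothing. [cite: Sprung2012, Def. 6.1 (p. 1495), Thm. 7.14 (3) (p. 1504), Prop. 7.19 (p. 1505)]
[cite: PerrinRiou2003, §7.1 Conj. 7.1 (p. 170)] [cite: Miller2011LMS, Def. 1.1] -/
theorem wAllCornerX8_of_K1_of_sharpFlatMuAn_of_publishedInputs (hK1 : SprungLowerDivisibilityAtThree)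
    (hAn : SharpFlatMuAnSmallImageX8) (hCK : InputSharpFlatColemanKatoZeta) (hPub : PublishedInputsX8)
    (hGZK : RankEqAnalyticRankLeOne) : Summit.BirchSwinnertonDyer.WAllCornerX8 :=
  wAllCornerX8_of_K1_of_sharpFlatMuAn hK1 hAn ⟨hCK, hPub.2.2.2.2.2.2.1⟩ hPub hGZK

end Summit.BirchSwinnertonDyer.BirchSwinnertonDyer.Theorems.PrintX8Residual

end
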